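import Mathlib.MeasureTheory.Integral.Prod
import Literature.Analysis.FunctionSpaces.TorusTimePeriodization
import Literature.Analysis.FunctionSpaces.TorusSpaceTimeFields
import HarnessLib

/-!
# Stub `stub_krPeriodicExtension` (H7) of the plan for `stub_kolmogorovRieszPeriodicSlab`
(line `tight`, crux `EulerLimit.EulerlimitThesisV2`, stmt-AnomalousDissipation-0511)

Periodisation of the `L³`-limit representative: a field `V : ℝ → T^d → F`, jointly (a.e.-strongly)
measurable on `(0,τ) × T^d`, is replaced by the `τ`-periodic field `w := timePeriodize 0 τ V`
(`Literature.Analysis.FunctionSpaces.timePeriodize`), which agrees with `V` on the window `(0,τ)`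
and whose space–time lift `stLift w` is a.e.-strongly measurable on `(0,τ) × ℝ^d`
(`Torus.aestronglyMeasurable_stLift_of_uncurry` for `V`, transported along the a.e.-equality on the
window).  Generic in the torus index `d` and the value space `F`; the file ends with the
REGISTERED sub-stub `stub_krPeriodicExtension` (`d = Fin 3`, `F = ℝ³`), signature verbatim.
-/

noncomputable section

-- D-0017: single-problem summit ⇒ the duplicated namespace segment is by design.
set_option linter.dupNamespace false

open MeasureTheory Set Function Filter

namespace Summit.AnomalousDissipation.AnomalousDissipation.Theorems.EulerLimitKR

open Literature.Analysis.FunctionSpaces Literature.Analysis.FunctionSpaces.Torus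

/-- **Periodic extension of a representative (H7).** For `τ > 0` and `V : ℝ → T^d → F` with
`uncurry V` a.e.-strongly measurable for `(vol|(0,τ)) ⊗ vol`, the periodisation
`w := timePeriodize 0 τ V` is `τ`-periodic, equals `V` at every `t ∈ (0,τ)`, and `stLift w` is
a.e.-strongly measurable on `(0,τ) × ℝ^d`. [folklore] -/
theorem exists_periodic_extension {d : Type*} [Fintype d] {F : Type*} [TopologicalSpace F]
    {τ : ℝ} (hτ : 0 < τ) (V : ℝ → UnitAddTorus d → F)
    (hV : AEStronglyMeasurable (uncurry V) ((volume.restrict (Ioo 0 τ)).prod volume)) :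
    ∃ w : ℝ → UnitAddTorus d → F, Function.Periodic w τ ∧ (∀ t ∈ Ioo 0 τ, w t = V t) ∧
      AEStronglyMeasurable (stLift w) (volume.restrict (Ioo 0 τ ×ˢ univ)) := by
  have hwin : ∀ t ∈ Ioo 0 τ, timePeriodize 0 τ V t = V t := fun t ht =>
    timePeriodize_eq_self hτ V ⟨ht.1.le, by rw [zero_add]; exact ht.2⟩
  refine ⟨timePeriodize 0 τ V, periodic_timePeriodize hτ V, hwin, ?_⟩
  have h1 : AEStronglyMeasurable (stLift V)
      (volume.restrict (Ioo 0 τ ×ˢ (univ : Set (EuclideanSpace ℝ d)))) :=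
    aestronglyMeasurable_stLift_of_uncurry hV
  refine h1.congr ?_
  filter_upwards [ae_restrict_mem (measurableSet_Ioo.prod MeasurableSet.univ)] with p hp
  obtain ⟨t, y⟩ := p
  rw [stLift_apply, stLift_apply, hwin t (mem_prod.1 hp).1]

/-- **Registered sub-stub `stub_krPeriodicExtension`** (H7 of the STUB-PLAN for
`stub_kolmogorovRieszPeriodicSlab`, `d = Fin 3`): periodise the `L³((0,τ) × 𝕋³)`-limit
representative `V` to a `τ`-periodic field agreeing with `V` on `(0,τ)` whose space–time lift is
a.e.-strongly measurable on `(0,τ) × ℝ³` (`exists_periodic_extension`). [folklore] -/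
theorem stub_krPeriodicExtension :
    ∀ (τ : ℝ) (V : ℝ → UnitAddTorus (Fin 3) → EuclideanSpace ℝ (Fin 3)), 0 < τ → MeasureTheory.AEStronglyMeasurable (Function.uncurry V) ((MeasureTheory.volume.restrict (Set.Ioo 0 τ)).prod MeasureTheory.volume) → ∃ w : ℝ → UnitAddTorus (Fin 3) → EuclideanSpace ℝ (Fin 3), Function.Periodic w τ ∧ (∀ t ∈ Set.Ioo 0 τ, w t = V t) ∧ MeasureTheory.AEStronglyMeasurable (Literature.Analysis.FunctionSpaces.Torus.stLift w) (MeasureTheory.volume.restrict (Set.Ioo 0 τ ×ˢ Set.univ)) :=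
  fun _τ V hτ hV => exists_periodic_extension hτ V hV

end Summit.AnomalousDissipation.AnomalousDissipation.Theorems.EulerLimitKR

end
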